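import Summits.QuantumAdvantage.QuantumAdvantage.Theorems.SosSandwichPseudoBoundedAASqrtInfluenceAddress
import Mathlib.Analysis.SpecificLimits.Normed
import HarnessLib

/-!
# Crux `DecoupledCoreAA` (stmt-QuantumAdvantage-17872), line `l1-family`, stub `stub_l1Family` —
# the ADDRESS FAMILY in kernel: neither alternative of the dichotomy can be dropped

`stub_l1Family` (`Cruxes/AAConj/Lines/l1_family.lean`; the one open stub upstream of `AAConj` and of
`SosSandwich.PseudoBoundedAA`) concludes a DICHOTOMY for an ℓ¹-bounded family `g_1,…,g_N` of degree-`≤ d` cube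
polynomials with total mass `Σ_i E[g_i²] ≥ 1/(K₀ d^κ₀)`: (A) a member of mass `≥ C/d^c`, OR (B) a coordinate `j` of
aggregate influence `Σ_i E[(g_i − g_i^{⊕j})²] ≥ C/d^c`.  The line card records (informally) that (A) alone is false —
this file puts the witnesses in kernel, in the stub's exact vocabulary:

* §1 `addr_flipBit_castAdd_ne`, `exists_addrClassPoly` — the indicator of the address class `{addr x = t}` on
  `m + 2^m` bits is a polynomial of total degree `≤ m`; flipping an address bit moves the address.
* §2 `exists_addressFamily` — **the address family** `g_t = 1[addr = t]` (`t < 2^m`, padded by zeros to `Fin (m+2^m)`):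
  degrees `≤ m`, `Σ_i |g_i(z)| = 1` pointwise, every mass `= 2^{-m}`, total mass `1`, and for every ADDRESS bit `j`
  the aggregate influence `Σ_i E[(g_i − g_i^{⊕j})²] = 2`.
* §3 `not_l1Family_memberOnly` — **alternative (A) alone is FALSE** (the stub's statement with (B) deleted is refuted:
  regime `(κ₀, K₀) = (0, 1)`, `d = m → ∞`, masses `2^{-m} < C/m^c`); `not_l1Family_coordinateOnly` — **(B) alone is
  FALSE** (one constant member: mass `1`, all aggregate influences `0`); `addressFamily_alternativeB` — the address
  family itself satisfies (B) with the absolute constant `2`, consistent with the dichotomy.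

So the registered dichotomy is irreducible: a proof of `stub_l1Family` must produce (A) on some inputs and (B) on
others (companion `…L1FamilyExpRung`: (A) alone does hold at scale `9^{-d}`).  Honest label: calibration of the open
stub; no stub, crux or summit is closed.  Sources: de Wolf 2008 §4.4 (address function); O'Donnell–Zhao
arXiv:1512.01603 eqn. (2.1), Thm. 2.13; Aaronson–Ambainis arXiv:0911.0996 Conj. 6.
-/

-- D-0017: single-conjunct summit ⇒ the duplicate `QuantumAdvantage.QuantumAdvantage` is mandated.
set_option linter.dupNamespace false

noncomputable section

open Finset Filter
open Literature.Computability.QuantumComplexity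
open Literature.Computability.QuantumComplexity.AddressFunction (addr digits)
open Summit.QuantumAdvantage.QuantumAdvantage.Theorems.SosSandwich.SqrtInfluenceAddress (addr_eq_iff boolAvg_ite_addr)

namespace Summit.QuantumAdvantage.QuantumAdvantage.Cruxes.DecoupledCoreAA.L1Family.Address

variable {m : ℕ}

/-! ### §1 Address classes: indicator polynomials, and address bits move the address -/

/-- Flipping an ADDRESS bit changes the address (the digit map is injective). [cite: DeWolf2008, §4.4 p. 10] -/
theorem addr_flipBit_castAdd_ne (x : Fin (m + 2 ^ m) → Bool) (j : Fin m) :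
    addr (flipBit (Fin.castAdd (2 ^ m) j) x) ≠ addr x := by
  intro h
  have h' := congr_fun (finFunctionFinEquiv.injective h) j
  unfold digits at h'
  rw [flipBit, Function.update_self] at h'
  cases hx : x (Fin.castAdd (2 ^ m) j) <;> simp [hx] at h'

/-- **The indicator of an address class is a polynomial of total degree `≤ m`**: `Π_j ℓ_{t,j}` with
`ℓ_{t,j} ∈ {x_j, 1 - x_j}` chosen by the digits of `t` has cube values `1[addr x = t]` (the product inside de Wolf's
representation `Σ_t (Π_j ℓ_{t,j}) y_t` of the address function). [cite: DeWolf2008, §4.4 p. 10] -/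
theorem exists_addrClassPoly (t : Fin (2 ^ m)) : ∃ r : MvPolynomial (Fin (m + 2 ^ m)) ℝ,
    r.totalDegree ≤ m ∧ ∀ x, evalBool r x = if addr x = t then 1 else 0 := by
  classical
  -- adapted from `SqrtInfluenceAddress.exists_addrPoly` (the product factor of the address polynomial)
  set dB : Fin m → Bool := fun j => decide ((finFunctionFinEquiv.symm t) j = 1) with hdB
  set L : Fin m → MvPolynomial (Fin (m + 2 ^ m)) ℝ := fun j =>
    if dB j = true then MvPolynomial.X (Fin.castAdd (2 ^ m) j)
    else 1 - MvPolynomial.X (Fin.castAdd (2 ^ m) j) with hL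
  refine ⟨∏ j : Fin m, L j, ?_, ?_⟩
  · have hL1 : ∀ j, (L j).totalDegree ≤ 1 := by
      intro j
      by_cases h : dB j = true
      · have e : L j = MvPolynomial.X (Fin.castAdd (2 ^ m) j) := by rw [hL]; exact if_pos h
        rw [e, MvPolynomial.totalDegree_X]
      · have e : L j = 1 - MvPolynomial.X (Fin.castAdd (2 ^ m) j) := by rw [hL]; exact if_neg h
        rw [e]
        refine (MvPolynomial.totalDegree_sub _ _).trans ?_
        rw [MvPolynomial.totalDegree_one, MvPolynomial.totalDegree_X]
        simp
    refine (MvPolynomial.totalDegree_finsetProd _ _).trans ?_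
    calc ∑ j : Fin m, (L j).totalDegree ≤ ∑ _j : Fin m, 1 := Finset.sum_le_sum fun j _ => hL1 j
      _ = m := by simp
  · intro x
    have hLev : ∀ j, evalBool (L j) x = if x (Fin.castAdd (2 ^ m) j) = dB j then 1 else 0 := by
      intro j
      unfold evalBool
      by_cases h : dB j = true
      · have e : L j = MvPolynomial.X (Fin.castAdd (2 ^ m) j) := by rw [hL]; exact if_pos h
        rw [e, MvPolynomial.eval_X, h]
      · have e : L j = 1 - MvPolynomial.X (Fin.castAdd (2 ^ m) j) := by rw [hL]; exact if_neg h
        rw [Bool.not_eq_true] at h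
        rw [e, map_sub, map_one, MvPolynomial.eval_X, h]
        cases x (Fin.castAdd (2 ^ m) j) <;> simp
    have e1 : evalBool (∏ j : Fin m, L j) x = ∏ j : Fin m, evalBool (L j) x := by
      unfold evalBool; rw [map_prod]
    rw [e1]
    simp_rw [hLev]
    rw [Finset.prod_boole]
    have hiff : (∀ j ∈ (Finset.univ : Finset (Fin m)), x (Fin.castAdd (2 ^ m) j) = dB j) ↔ addr x = t := by
      rw [addr_eq_iff]
      simp [hdB]
    simp only [hiff]

/-! ### §2 The address family -/

/-- For two DISTINCT addresses `s ≠ s'`, the indicator vectors `(1[s = t])_t`, `(1[s' = t])_t` differ in squared `ℓ²`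
by exactly `2`. [folklore] -/
theorem sum_sq_ite_sub_ite {s s' : Fin (2 ^ m)} (h : s' ≠ s) :
    ∑ t : Fin (2 ^ m), ((if s = t then (1 : ℝ) else 0) - (if s' = t then (1 : ℝ) else 0)) ^ 2 = 2 := by
  have hexp : ∀ t : Fin (2 ^ m), ((if s = t then (1 : ℝ) else 0) - (if s' = t then (1 : ℝ) else 0)) ^ 2 =
      (if s = t then (1 : ℝ) else 0) + (if s' = t then (1 : ℝ) else 0) := by
    intro t
    by_cases h1 : s = t
    · have h2 : ¬ s' = t := fun h2 => h (h2.trans h1.symm)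
      simp [h1, h2]
    · by_cases h2 : s' = t
      · simp [h1, h2]
      · simp [h1, h2]
  simp_rw [hexp]
  rw [Finset.sum_add_distrib, Finset.sum_ite_eq Finset.univ s, Finset.sum_ite_eq Finset.univ s',
    if_pos (Finset.mem_univ _), if_pos (Finset.mem_univ _)]
  norm_num

/-- Sums over the cube commute with `boolAvg` (finite linearity). [folklore] -/
theorem sum_boolAvg_eq {N : ℕ} {ι : Type*} [Fintype ι] (f : ι → (Fin N → Bool) → ℝ) :
    ∑ i, boolAvg (f i) = boolAvg fun z => ∑ i, f i z := by
  unfold boolAvg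
  rw [← Finset.sum_div, Finset.sum_comm]

/-- **The address family.** On `N = m + 2^m` variables there is a family `g : Fin N → ℝ[x_1..x_N]`
(`g_{m+t} = 1[addr = t]` for `t < 2^m`, `g_j = 0` for `j < m`) with: every total degree `≤ m`; `Σ_i |g_i(z)| = 1` at
EVERY point; every member of mass `E[g_i²] ≤ 2^{-m}`; total mass `Σ_i E[g_i²] = 1`; and for every ADDRESS bit `j < m`
the aggregate influence `Σ_i E[(g_i − g_i^{⊕j})²] = 2`.  (As a decoupled polynomial `1/2 + (1/2)Σ_t (±1)^{y_t} g_t(z)` it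
is the address function: tiny `y`-influences, address bits of influence `≍ 1`.) [cite: DeWolf2008, §4.4 p. 10]
[cite: ODonnellZhao2016, eqn. (2.1)] -/
theorem exists_addressFamily (m : ℕ) :
    ∃ g : Fin (m + 2 ^ m) → MvPolynomial (Fin (m + 2 ^ m)) ℝ,
      (∀ i, (g i).totalDegree ≤ m) ∧
      (∀ z, ∑ i, |evalBool (g i) z| = 1) ∧
      (∀ i, boolAvg (fun z => evalBool (g i) z ^ 2) ≤ 1 / (2 : ℝ) ^ m) ∧
      ∑ i, boolAvg (fun z => evalBool (g i) z ^ 2) = 1 ∧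
      (∀ j : Fin m, ∑ i, boolAvg (fun z =>
        (evalBool (g i) z - evalBool (g i) (flipBit (Fin.castAdd (2 ^ m) j) z)) ^ 2) = 2) := by
  classical
  choose r hrdeg hrev using fun t : Fin (2 ^ m) => exists_addrClassPoly t
  refine ⟨Fin.append (fun _ : Fin m => (0 : MvPolynomial (Fin (m + 2 ^ m)) ℝ)) r, ?_, ?_, ?_, ?_, ?_⟩
  · -- degrees
    intro i
    refine Fin.addCases (fun j => ?_) (fun t => ?_) i
    · rw [Fin.append_left, MvPolynomial.totalDegree_zero]; exact Nat.zero_le _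
    · rw [Fin.append_right]; exact hrdeg t
  · -- pointwise ℓ¹ mass exactly 1
    intro z
    rw [Fin.sum_univ_add]
    simp only [Fin.append_left, Fin.append_right]
    have h0 : evalBool (0 : MvPolynomial (Fin (m + 2 ^ m)) ℝ) z = 0 := by unfold evalBool; exact map_zero _
    simp_rw [h0, abs_zero, Finset.sum_const_zero, zero_add, hrev]
    have habs : ∀ t : Fin (2 ^ m), |(if addr z = t then (1 : ℝ) else 0)| = if addr z = t then (1 : ℝ) else 0 :=
      fun t => by split_ifs <;> simp
    simp_rw [habs]
    rw [Finset.sum_ite_eq Finset.univ (addr z), if_pos (Finset.mem_univ _)]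
  · -- every mass ≤ 2^{-m}
    intro i
    refine Fin.addCases (fun j => ?_) (fun t => ?_) i
    · have h0 : ∀ z, evalBool (Fin.append (fun _ : Fin m => (0 : MvPolynomial (Fin (m + 2 ^ m)) ℝ)) r
          (Fin.castAdd (2 ^ m) j)) z = 0 := by
        intro z; rw [Fin.append_left]; unfold evalBool; exact map_zero _
      simp_rw [h0]
      rw [zero_pow two_ne_zero, boolAvg_const]
      positivity
    · simp_rw [Fin.append_right, hrev t]
      have hsq : ∀ z : Fin (m + 2 ^ m) → Bool,
          (if addr z = t then (1 : ℝ) else 0) ^ 2 = if addr z = t then (1 : ℝ) else 0 :=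
        fun z => by split_ifs <;> simp
      simp_rw [hsq]
      rw [boolAvg_ite_addr t]
  · -- total mass 1
    rw [sum_boolAvg_eq]
    have h1 : ∀ z : Fin (m + 2 ^ m) → Bool,
        ∑ i, evalBool (Fin.append (fun _ : Fin m => (0 : MvPolynomial (Fin (m + 2 ^ m)) ℝ)) r i) z ^ 2 = 1 := by
      intro z
      rw [Fin.sum_univ_add]
      simp only [Fin.append_left, Fin.append_right]
      have h0 : evalBool (0 : MvPolynomial (Fin (m + 2 ^ m)) ℝ) z = 0 := by unfold evalBool; exact map_zero _
      simp_rw [h0, zero_pow two_ne_zero, Finset.sum_const_zero, zero_add, hrev]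
      have hsq : ∀ t : Fin (2 ^ m), (if addr z = t then (1 : ℝ) else 0) ^ 2 = if addr z = t then (1 : ℝ) else 0 :=
        fun t => by split_ifs <;> simp
      simp_rw [hsq]
      rw [Finset.sum_ite_eq Finset.univ (addr z), if_pos (Finset.mem_univ _)]
    simp_rw [h1]
    exact boolAvg_const 1
  · -- address bits: aggregate influence exactly 2
    intro j
    rw [sum_boolAvg_eq]
    have h2 : ∀ z : Fin (m + 2 ^ m) → Bool,
        ∑ i, (evalBool (Fin.append (fun _ : Fin m => (0 : MvPolynomial (Fin (m + 2 ^ m)) ℝ)) r i) z -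
          evalBool (Fin.append (fun _ : Fin m => (0 : MvPolynomial (Fin (m + 2 ^ m)) ℝ)) r i)
            (flipBit (Fin.castAdd (2 ^ m) j) z)) ^ 2 = 2 := by
      intro z
      rw [Fin.sum_univ_add]
      simp only [Fin.append_left, Fin.append_right]
      have h0 : ∀ w, evalBool (0 : MvPolynomial (Fin (m + 2 ^ m)) ℝ) w = 0 := by
        intro w; unfold evalBool; exact map_zero _
      simp_rw [h0, sub_zero, zero_pow two_ne_zero, Finset.sum_const_zero, zero_add, hrev]
      exact sum_sq_ite_sub_ite (addr_flipBit_castAdd_ne z j)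
    simp_rw [h2]
    exact boolAvg_const 2

/-! ### §3 Neither alternative of `stub_l1Family` can be dropped -/

/-- Exponentials beat polynomials: for `C > 0` and `c` there is `m ≥ 1` with `m^c < C·2^m`. [folklore] -/
theorem exists_pow_lt_mul_two_pow (c : ℕ) {C : ℝ} (hC : 0 < C) :
    ∃ m : ℕ, 1 ≤ m ∧ (m : ℝ) ^ c < C * (2 : ℝ) ^ m := by
  have ht := tendsto_pow_const_div_const_pow_of_one_lt c (show (1 : ℝ) < 2 by norm_num)
  have hev : ∀ᶠ n : ℕ in atTop, (n : ℝ) ^ c / (2 : ℝ) ^ n < C := ht.eventually (gt_mem_nhds hC)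
  obtain ⟨M, hM⟩ := hev.exists_forall_of_atTop
  refine ⟨max M 1, le_max_right _ _, ?_⟩
  have h := hM (max M 1) (le_max_left _ _)
  have h2 : (0 : ℝ) < (2 : ℝ) ^ (max M 1) := by positivity
  rw [div_lt_iff₀ h2] at h
  exact h

/-- **Alternative (A) alone is FALSE.** The statement of `stub_l1Family` with the coordinate alternative deleted —
"an ℓ¹-bounded degree-`≤ d` family in the regime `1 ≤ K₀ d^κ₀ Σ_i E[g_i²]` has a member of mass `≥ C/d^c`" — is
refuted by the address family: regime `(κ₀, K₀) = (0, 1)`, `d = m`, total mass `1`, every mass `2^{-m} < C/m^c` for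
`m` large.  (The strategist's first draft of the line, recorded dead on the line card; here in kernel.)
[cite: ODonnellZhao2016, eqn. (2.1)] [cite: DeWolf2008, §4.4 p. 10] -/
theorem not_l1Family_memberOnly :
    ¬ (∀ (κ₀ : ℕ) (K₀ : ℝ), 0 < K₀ → ∃ (c : ℕ) (C : ℝ), 0 < C ∧
      ∀ (N d : ℕ) (g : Fin N → MvPolynomial (Fin N) ℝ), 1 ≤ d → (∀ i, (g i).totalDegree ≤ d) →
        (∀ z, ∑ i, |evalBool (g i) z| ≤ 1) →
        1 ≤ K₀ * (d : ℝ) ^ κ₀ * ∑ i, boolAvg (fun z => evalBool (g i) z ^ 2) →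
        ∃ i, C / (d : ℝ) ^ c ≤ boolAvg (fun z => evalBool (g i) z ^ 2)) := by
  intro h
  obtain ⟨c, C, hC, hh⟩ := h 0 1 one_pos
  obtain ⟨m, hm, hlt⟩ := exists_pow_lt_mul_two_pow c hC
  obtain ⟨g, hdeg, hl1, hmass, htot, -⟩ := exists_addressFamily m
  have hreg : 1 ≤ (1 : ℝ) * (m : ℝ) ^ 0 * ∑ i, boolAvg (fun z => evalBool (g i) z ^ 2) := by
    rw [htot]; norm_num
  obtain ⟨i, hi⟩ := hh (m + 2 ^ m) m g hm hdeg (fun z => (hl1 z).le) hreg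
  have hle : C / (m : ℝ) ^ c ≤ 1 / (2 : ℝ) ^ m := hi.trans (hmass i)
  have hm0 : (0 : ℝ) < (m : ℝ) ^ c := by positivity
  have h2 : (0 : ℝ) < (2 : ℝ) ^ m := by positivity
  rw [div_le_div_iff₀ hm0 h2, one_mul] at hle
  linarith

/-- **Alternative (B) alone is FALSE.** The statement of `stub_l1Family` with the member alternative deleted is
refuted by ONE CONSTANT MEMBER (`N = d = 1`, `g_0 = 1`: ℓ¹-mass `1`, total mass `1`, every aggregate influence `0`).
[cite: ODonnellZhao2016, eqn. (2.1)] -/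
theorem not_l1Family_coordinateOnly :
    ¬ (∀ (κ₀ : ℕ) (K₀ : ℝ), 0 < K₀ → ∃ (c : ℕ) (C : ℝ), 0 < C ∧
      ∀ (N d : ℕ) (g : Fin N → MvPolynomial (Fin N) ℝ), 1 ≤ d → (∀ i, (g i).totalDegree ≤ d) →
        (∀ z, ∑ i, |evalBool (g i) z| ≤ 1) →
        1 ≤ K₀ * (d : ℝ) ^ κ₀ * ∑ i, boolAvg (fun z => evalBool (g i) z ^ 2) →
        ∃ j, C / (d : ℝ) ^ c ≤
          ∑ i, boolAvg (fun z => (evalBool (g i) z - evalBool (g i) (flipBit j z)) ^ 2)) := by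
  intro h
  obtain ⟨c, C, hC, hh⟩ := h 0 1 one_pos
  have h1 : ∀ z : Fin 1 → Bool, evalBool (1 : MvPolynomial (Fin 1) ℝ) z = 1 := by
    intro z; unfold evalBool; exact map_one _
  have hdeg : ∀ i : Fin 1, ((fun _ => (1 : MvPolynomial (Fin 1) ℝ)) i).totalDegree ≤ 1 := by
    intro i; simp
  have hl1 : ∀ z : Fin 1 → Bool, ∑ i : Fin 1, |evalBool ((fun _ => (1 : MvPolynomial (Fin 1) ℝ)) i) z| ≤ 1 := by
    intro z; simp [h1]
  have hreg : 1 ≤ (1 : ℝ) * ((1 : ℕ) : ℝ) ^ 0 *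
      ∑ i : Fin 1, boolAvg (fun z => evalBool ((fun _ => (1 : MvPolynomial (Fin 1) ℝ)) i) z ^ 2) := by
    simp [h1]
  obtain ⟨j, hj⟩ := hh 1 1 (fun _ => 1) le_rfl hdeg hl1 hreg
  simp [h1] at hj
  linarith

/-- **The address family lies in alternative (B) with an absolute constant**: it meets every hypothesis of
`stub_l1Family` at `d = m` in the regime `(κ₀, K₀) = (0, 1)`, has NO member of mass `> 2^{-m}`, and has a coordinate of
aggregate influence `2 ≥ C/d^c` whenever `C ≤ 2` — consistent with the dichotomy, and showing where a proof must send
it. [cite: ODonnellZhao2016, eqn. (2.1)] [cite: DeWolf2008, §4.4 p. 10] -/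
theorem addressFamily_alternativeB {m : ℕ} (hm : 1 ≤ m) :
    ∃ g : Fin (m + 2 ^ m) → MvPolynomial (Fin (m + 2 ^ m)) ℝ,
      (∀ i, (g i).totalDegree ≤ m) ∧ (∀ z, ∑ i, |evalBool (g i) z| ≤ 1) ∧
      1 ≤ (1 : ℝ) * (m : ℝ) ^ 0 * ∑ i, boolAvg (fun z => evalBool (g i) z ^ 2) ∧
      (∀ i, boolAvg (fun z => evalBool (g i) z ^ 2) ≤ 1 / (2 : ℝ) ^ m) ∧
      ∃ j, (2 : ℝ) ≤ ∑ i, boolAvg (fun z => (evalBool (g i) z - evalBool (g i) (flipBit j z)) ^ 2) := by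
  obtain ⟨g, hdeg, hl1, hmass, htot, hcoord⟩ := exists_addressFamily m
  refine ⟨g, hdeg, fun z => (hl1 z).le, by rw [htot]; norm_num, hmass, ?_⟩
  exact ⟨Fin.castAdd (2 ^ m) ⟨0, hm⟩, (hcoord ⟨0, hm⟩).ge⟩

end Summit.QuantumAdvantage.QuantumAdvantage.Cruxes.DecoupledCoreAA.L1Family.Address

end
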